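import Summits.BirchSwinnertonDyer.BirchSwinnertonDyer.Theorems.Rank2Observatory2DescClFieldCertESQ
import Summits.BirchSwinnertonDyer.BirchSwinnertonDyer.Theorems.Rank2Observatory2DescClRealCurveCertSDefs
import HarnessLib

/-!
# BirchSwinnertonDyer — rank ≥ 2 observatory: KERNEL-2DESC-CL v3.0, SSQ1 — THE SPLIT-2 FIELD CORE OVER A TOTALLY SPLIT `q`

HONEST FRAMING: per-curve certified theorems and census instruments; no claim on BSD in rank ≥ 2.

First generic file of the «SSQ» variant (RULING A″.5 (3), director-bsd 2026-08-28; design note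
`…/kernel-2desc-cl/v2/generics/cq/v2-g53/ssq/SSQ-DESIGN.md`): the split-2 (S-type: `2` totally split, fractional
elements `X / m₁`, class certificates at the primes above `2`) per-field layer of `…ClFieldCertS` /
`…ClRealCurveCertSDefs` re-based on a TOTALLY SPLIT auxiliary prime `(q) = W_0 W_1 W_2` (SQ1 `…ClSplitQ`:
`checkReg3`, `WQ`, `qcover_of_reg3`) — the only presentation available in a CYCLIC cubic field (no prime of type
`(1,2)`; `f61.checkReg = false`).  The record types `ClFieldCertS`, `ClFieldCertS2`, `ClFieldCertRS2` are REUSED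
(`base.qr = (r_0, r_1, r_2)`); new declarations only:
* `ClFieldCertS.checkCoreS3` = the landed `checkCoreS` with `checkReg3` for `checkReg` (split certificate, helper,
  split sweep verbatim — its class certificates are relative to «ideals containing `q`»), its projections, and
  **`closure_q_eq_top_of_coreS3`**: the classes of the primes above `q` generate the class group (the landed proof; a
  sweep prime above `q` is some `WQ i`);
* `ClFieldCertRS2.check2RS3` = archimedean clause ∧ `checkCoreS3` ∧ constants, with projections.
Sorry-free; axioms `propext`, `Classical.choice`, `Quot.sound`.
[cite: Marcus2018, Ch. 5, Cor. 2 to Thm. 35] [cite: Cohen1993, §4.8.2, §6.5]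
-/

set_option linter.dupNamespace false

noncomputable section

open scoped Classical NumberField nonZeroDivisors

open Literature.NumberTheory.NumberFields Polynomial Module NumberField IsDedekindDomain Ideal

namespace Summit.BirchSwinnertonDyer.BirchSwinnertonDyer.Rank2Observatory.TwoDescCl

open TwoDescCubic

variable {K : Type*} [Field K] [NumberField K] {θ : K}

namespace ClFieldCertS

variable (fs : ClFieldCertS)

/-- **The signature-free split core over a totally split `q`**: the split-`q` registry core of `base` (SQ1 `checkReg3`), the split certificate, the helper's integrality and
irreducibility, the split sweep. Computable; run once per field by `decide +kernel`. -/
def checkCoreS3 : Bool :=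
  fs.base.checkReg3 && (fs.split.check fs.base.a fs.base.b fs.base.c && (fs.dh.check fs.base.a fs.base.b fs.base.c &&
    (noRootMod fs.pIrrS fs.a' fs.b' fs.c' && fs.checkSweepS)))

/-! ## Soundness -/

/-- The registry core of `base` holds. -/
theorem checkReg3_of_coreS3 (hS : fs.checkCoreS3 = true) : fs.base.checkReg3 = true := by
  simp only [checkCoreS3, Bool.and_eq_true] at hS; exact hS.1

/-- The split certificate holds. -/
theorem splitCheck_of_coreS3 (hS : fs.checkCoreS3 = true) : fs.split.check fs.base.a fs.base.b fs.base.c = true := by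
  simp only [checkCoreS3, Bool.and_eq_true] at hS; exact hS.2.1

/-- The helper is integral. -/
theorem dhCheck_of_coreS3 (hS : fs.checkCoreS3 = true) : fs.dh.check fs.base.a fs.base.b fs.base.c = true := by
  simp only [checkCoreS3, Bool.and_eq_true] at hS; exact hS.2.2.1

/-- `h` is irreducible. [folklore] -/
theorem irreducibleS3 (hS : fs.checkCoreS3 = true) : Irreducible (MonicCubic.polyQ fs.a' fs.b' fs.c') := by
  simp only [checkCoreS3, Bool.and_eq_true] at hS; exact irreducible_of_noRootMod hS.2.2.2.1

/-- `θ' = dh` is a root of `h`. [folklore] -/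
theorem aeval_dh3 (hθ : aeval θ (MonicCubic.poly fs.base.a fs.base.b fs.base.c) = 0) (hS : fs.checkCoreS3 = true) :
    aeval (fs.dh.val θ) (MonicCubic.poly fs.a' fs.b' fs.c') = 0 :=
  FracElt.aeval_val hθ (fs.dhCheck_of_coreS3 hS)

/-- **The classes of the primes above `q` generate the class group** (split sweep; a sweep prime above `q` is one of
the three `WQ i` of SQ1).
[cite: Marcus2018, Ch. 5, Cor. 2 to Thm. 35] [cite: Cohen1993, §6.5] -/
theorem closure_q_eq_top_of_coreS3 (hθ : aeval θ (MonicCubic.poly fs.base.a fs.base.b fs.base.c) = 0)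
    (h3 : finrank ℚ K = 3) (hS : fs.checkCoreS3 = true) (hpr : fs.base.primeList.Forall Nat.Prime) :
    Subgroup.closure {cc : ClassGroup (𝓞 K) | ∃ (J : Ideal (𝓞 K)) (hJ : J ∈ (Ideal (𝓞 K))⁰),
      ((fs.base.q : ℕ) : 𝓞 K) ∈ J ∧ ClassGroup.mk0 ⟨J, hJ⟩ = cc} = ⊤ := by
  have hR := fs.checkReg3_of_coreS3 hS
  have hsplit := fs.splitCheck_of_coreS3 hS
  have hirr := fs.base.irreducible_of_reg3 hR
  have hirr' := fs.irreducibleS3 hS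
  have hη := fs.aeval_dh3 hθ hS
  have hq := fs.base.q_prime hpr
  have hS' := hS
  simp only [checkCoreS3, checkSweepS, Bool.and_eq_true, decide_eq_true_eq, List.all_eq_true, List.mem_range,
    Bool.or_eq_true, beq_iff_eq, List.any_eq_true] at hS'
  obtain ⟨-, -, -, -, hd, hcov, hcls, hcls2⟩ := hS'
  refine eq_top_of_classIn_lt_gcd hirr hθ hirr' hη h3 (b := fs.base.bM) hd fun p hpb hp P hP hlt => ?_
  have hpP : (p : 𝓞 K) ∈ P := sweep_natCast_mem p hP
  have hPr : P.IsPrime := hP.1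
  rcases hcov p hpb with (((hlt2 | hsf) | rfl) | rfl) | ⟨e, he, hep⟩
  · exact absurd hp.two_le (by omega)
  · rw [ClFieldCert.smallFactor_eq_false hp] at hsf; exact absurd hsf Bool.false_ne_true
  · obtain ⟨i, h⟩ := fs.base.qcover_of_reg3 hθ h3 hR hpr P hPr hpP
    rw [h]
    exact classIn_tsupp_span_pair_self _ _
  · -- `p = 2`: the split row
    exact SplitTwo.classIn_of_two_mem hirr hθ h3 hsplit hq fs.cls2 hcls2 P hPr hpP
  · subst hep
    have hrow := (fs.base.row_check_of_mem_reg3 hR he).1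
    have hp' := fs.base.prime_of_mem hpr he
    obtain ⟨C, hC, rfl⟩ := cover_of_check hirr hθ h3 hp' hrow P hPr hpP
    rcases hcls e he with hb | hall
    · exfalso
      refine not_pow_inertiaDeg_lt (mem_primesOver_of_check hirr hθ h3 hp' hrow hC)
        (absNorm_of_check hirr hθ h3 hp' hrow hC) ?_ hlt
      exact hb.trans (Nat.le_self_pow (ClFieldCert.codeDeg_pos C).ne' _)
    · rcases hall C hC with ⟨dd, -, hcc⟩ | ⟨ce, -, hce⟩
      · exact classIn_of_classCheck hirr hθ h3 hp' hrow hC hq hcc hlt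
      · exact classIn_of_classCertA hirr hθ h3 hp' hrow hC hq hce.2 hce.1

end ClFieldCertS

/-! ## The totally real per-field checker over a totally split `q` -/

namespace ClFieldCertRS2

variable (G : ClFieldCertRS2)

/-- **The per-field checker (totally split `q`)**: the archimedean clause of `fr`, the split core over the totally
split `q`, the constant clause. Computable; `decide +kernel` once per field. -/
def check2RS3 : Bool := G.fr.checkArch && (G.toS2.fs.checkCoreS3 && G.toS2.checkConst)

/-- The archimedean clause. -/
theorem checkArch_of_check2RS3 (h : G.check2RS3 = true) : G.fr.checkArch = true := by
  simp only [check2RS3, Bool.and_eq_true] at h; exact h.1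

/-- The split core clause. -/
theorem coreS3_of_check2RS3 (h : G.check2RS3 = true) : G.toS2.fs.checkCoreS3 = true := by
  simp only [check2RS3, Bool.and_eq_true] at h; exact h.2.1

/-- The constant clause. -/
theorem const_of_check2RS3 (h : G.check2RS3 = true) : G.toS2.checkConst = true := by
  simp only [check2RS3, Bool.and_eq_true] at h; exact h.2.2

end ClFieldCertRS2

end Summit.BirchSwinnertonDyer.BirchSwinnertonDyer.Rank2Observatory.TwoDescCl

end
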